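import Summits.Ventures.LatticeQCDFlow.Scaling.DirtySetDecay

/-!
HONEST FRAMING: exact (Metropolis-corrected) sampling algorithms for lattice gauge theory; figures
of merit are autocorrelation/cost numbers at stated couplings and volumes; no continuum-physics
claim.

# RegenerationTagChain — THE STALE SET WHEN TRANSPORTS ARE IMPERFECT: A SWAP OF A FRESH HUB VALUE ONTO A STALE COLD
# REPLICA REGENERATES IT ONLY WITH PROBABILITY `p` (AND DIRTIES THE HUB), A SWAP OF A STALE HUB VALUE ONTO A FRESH COLD
# REPLICA DIRTIES IT (REGENERATING THE HUB WITH PROBABILITY `q`), COLD UPDATES ARE IDLE, THE HOT UPDATE (WEIGHT `w₀`)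
# CLEANS THE HUB — AND STILL THE STALE SET EMPTIES GEOMETRICALLY: A LYAPUNOV DRIFT `QΦ ≤ (1−ρ)Φ` FOR
# `Φ = b·𝟙{hub stale} + #{stale cold replicas}` GIVES `P(D_n ≠ ∅) ≤ (1−ρ)ⁿ(K+b)/b` (lean-2 GEN-25, ours)

Venture-side (OURS).  Cell `lqcd-flow` (pub-lqcd), unit `pub-lqcd-lean-2-g25`, 2026-08-27.  Chapter M (the
coupon-collector ceiling WITHOUT perfect transports), file 1 — the set-valued chain alone.  Chapter L
(`Scaling/DirtySetDecay` … `Scaling/IdealStarMixingCeiling`) proved the `K·log K` mixing ceiling of the hot-only hub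
for PERFECT transports (one law at every level, every swap accepted): the set `D` of stale positions is then moved by
the swaps and emptied at the hub.  With imperfect transports a swap may be rejected and an accepted swap transports a
law that is not the target law; what survives (the sequel, `Scaling/DominatedStar…`) is REGENERATION: if the hot law
dominates the transported cold law one-sidedly, `p·μ_l(φ_r u) ≤ μ_0(u)`, a swap attempt of a FRESH hub value onto a
stale cold replica `l` leaves `l` exactly `μ_l`-distributed with probability `p` (Nummelin splitting of the accepted
move), whatever the stale value was; symmetrically a reverse constant `q·μ_0(u) ≤ μ_l(φ_r u)` regenerates the hub from
a fresh cold partner with probability `q`.  Conservative bookkeeping then gives the TAG CHAIN of this file on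
`Finset (Fin (K+1))` (hub list `κ`, entry `r` proposed with probability `t/m`, cold level `l_r = κ_r + 1`,
`σ_r = (0 l_r)`):
* `0 ∉ D`, `l_r ∉ D` (both fresh): `D ↦ D`;
* `0 ∉ D`, `l_r ∈ D`: `D ↦ σ_r(D) = D ∪ {0} ∖ {l_r}` with probability `p`, `D ↦ D ∪ {0}` with probability `1 − p`;
* `0 ∈ D`, `l_r ∉ D`: `D ↦ σ_r(D) = D ∪ {l_r} ∖ {0}` with probability `q`, `D ↦ D ∪ {l_r}` with probability `1 − q`;
* `0 ∈ D`, `l_r ∈ D`: `D ↦ D`;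
* with probability `(1−t)w₀` (the hot update, an exact sampler): `D ↦ D ∖ {0}`; with probability `(1−t)(1−w₀)`
  (cold updates, stationary for their laws): `D ↦ D`.
Uniformly: `D ↦ σ_r(D)` with probability `γ̄_r(D)` and `D ↦ B_r(D)` otherwise, where `γ̄_r(D) = 1, p, q, 0` in the
four cases and `B_r(D) = D` in the first case, `D ∪ {0, l_r}` in the others.  For `p = q = 1` this is EXACTLY the set
chain of `Scaling/DirtySetDecay`, made lazy by the cold updates.  Everything is carried as a hypothesis-equation
kernel `Q` (no definitions).

## What is proved

* §1 bookkeeping: `tagGood`/`tagBad` potentials (`Φ(σ_r D)`, `Φ(B_r D)` for `Φ(D) = Σ_{k∈D} φ_k`, `φ_0 = b`,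
  `φ_{l} = 1`), `regen_isRowStochastic`.
* §2 **`regen_step_potential_le` (THE DRIFT INEQUALITY)** — if `0 < b ≤ p`, `ρ ≤ t·c·(p − b)/m`,
  `ρ·b ≤ (1−t)w₀·b − t(1 − qb)` and `ρ ≤ t(1 − qb)·c/m` (`c` = the least hub multiplicity), then `QΦ ≤ (1−ρ)Φ`;
  **`regen_nonempty_le`** — `(δ_{univ} Qⁿ){D ≠ ∅} ≤ (1−ρ)ⁿ·(K + b)/b`.
* (the tuned constants — `b = p/2` under `4t ≤ p(1−t)w₀`, and `b = 1 − (1−t)w₀/2` for `p = q = 1` — are the sequel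
  `Scaling/RegenerationTagDecay`.)

Reading (no numerics implied): with a stale hub every swap attempt dirties a cold replica, so the hub weight `b` of
the potential must be paid for by the hub's cleaning rate `(1−t)w₀` — this is the one place where a condition on the
swap fraction enters (`t/((1−t)w₀) < p/(1 − pq)` is feasible; the corollary takes `4t ≤ p(1−t)w₀`); with it the
stale set empties at rate `t·c·p/(2m)`, i.e. in order `(m/(tcp))·log K` steps — `K·log K` at `m = cK`.  NOT CLAIMED
here: anything about configurations (the sequel proves that the tag chain dominates the distance to equilibrium of
the map-assisted hot-refreshed hub under one-sided domination).  Literature grade (cell rule): OWN COMPOSITION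
(Lyapunov drift for a finite set-valued chain); nothing cited as a fact; no new bib keys.
-/

noncomputable section

open Finset Function
open Literature.Probability.MarkovChains

namespace Summit.Ventures.LatticeQCDFlow.Scaling

variable {K m : ℕ} {t w₀ p q : ℝ} {Q : Finset (Fin (K + 1)) → Finset (Fin (K + 1)) → ℝ}

section Regen
variable (κ : Fin m → Fin K)

/-! ## §1 Bookkeeping: the potential of the good and the bad tag, row sums -/

/-- The potential `Φ(D) = Σ_{k∈D} φ_k` of the GOOD tag `σ_r(D)`, `σ_r = (0 l_r)`, `φ_0 = b`, `φ_l = 1` (`l ≠ 0`):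
`Φ(σ_r D) = Φ(D) + 𝟙{0∈D, l_r∉D}·(1 − b) + 𝟙{0∉D, l_r∈D}·(b − 1)`. [ours] -/
theorem tagPotential_swapImage (r : Fin m) (b : ℝ) (D : Finset (Fin (K + 1))) :
    ∑ k ∈ D.image (Equiv.swap (0 : Fin (K + 1)) (κ r).succ), (if k = (0 : Fin (K + 1)) then b else 1)
      = ∑ k ∈ D, (if k = (0 : Fin (K + 1)) then b else 1)
        + (if (0 : Fin (K + 1)) ∈ D then (if (κ r).succ ∈ D then 0 else 1 - b)
           else (if (κ r).succ ∈ D then b - 1 else 0)) := by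
  have hl0 : (κ r).succ ≠ (0 : Fin (K + 1)) := Fin.succ_ne_zero _
  rw [potential_image]
  -- compare termwise: only `k = 0` and `k = l` change
  have hterm : ∀ k : Fin (K + 1), (if Equiv.swap (0 : Fin (K + 1)) (κ r).succ k = 0 then b else (1 : ℝ))
      = (if k = (0 : Fin (K + 1)) then b else 1)
        + ((if k = (0 : Fin (K + 1)) then 1 - b else 0) + (if k = (κ r).succ then b - 1 else 0)) := by
    intro k
    by_cases hk0 : k = 0
    · subst hk0
      rw [Equiv.swap_apply_left, if_neg hl0, if_pos rfl, if_pos rfl, if_neg hl0.symm]; ring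
    · by_cases hkl : k = (κ r).succ
      · subst hkl
        rw [Equiv.swap_apply_right, if_pos rfl, if_neg hl0, if_neg hl0, if_pos rfl]; ring
      · rw [Equiv.swap_apply_of_ne_of_ne hk0 hkl, if_neg hk0, if_neg hk0, if_neg hkl]; ring
  simp_rw [hterm, sum_add_distrib]
  congr 1
  rw [sum_ite_eq' D, sum_ite_eq' D]
  split_ifs <;> ring

/-- The potential of the BAD tag `B_r(D)` (`= D` when both endpoints are fresh, `= D ∪ {0, l_r}` otherwise):
`Φ(B_r D) = Φ(D) + 𝟙{0∈D, l_r∉D}·1 + 𝟙{0∉D, l_r∈D}·b`. [ours] -/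
theorem tagPotential_badTag (r : Fin m) (b : ℝ) (D : Finset (Fin (K + 1))) :
    ∑ k ∈ (if (0 : Fin (K + 1)) ∉ D ∧ (κ r).succ ∉ D then D else insert (0 : Fin (K + 1)) (insert (κ r).succ D)),
        (if k = (0 : Fin (K + 1)) then b else 1)
      = ∑ k ∈ D, (if k = (0 : Fin (K + 1)) then b else 1)
        + (if (0 : Fin (K + 1)) ∈ D then (if (κ r).succ ∈ D then 0 else 1)
           else (if (κ r).succ ∈ D then b else 0)) := by
  have hl0 : (κ r).succ ≠ (0 : Fin (K + 1)) := Fin.succ_ne_zero _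
  by_cases h0 : (0 : Fin (K + 1)) ∈ D
  · rw [if_neg (fun h => h.1 h0), if_pos h0, Finset.insert_eq_of_mem (Finset.mem_insert_of_mem h0)]
    by_cases hl : (κ r).succ ∈ D
    · rw [if_pos hl, Finset.insert_eq_of_mem hl, add_zero]
    · rw [if_neg hl, Finset.sum_insert hl, if_neg hl0, add_comm]
  · rw [if_neg h0]
    by_cases hl : (κ r).succ ∈ D
    · rw [if_neg (fun h => h.2 hl), if_pos hl, Finset.insert_eq_of_mem hl, Finset.sum_insert h0, if_pos rfl, add_comm]
    · rw [if_pos ⟨h0, hl⟩, if_neg hl, add_zero]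

/-- The weights `γ̄_r(D) ∈ {1, p, q, 0}` lie in `[0,1]` (`0 ≤ p, q ≤ 1`). [ours] -/
theorem goodWeight_mem {gbar : Fin m → Finset (Fin (K + 1)) → ℝ}
    (hg : ∀ r D, gbar r D = if (0 : Fin (K + 1)) ∉ D then (if (κ r).succ ∉ D then (1 : ℝ) else p)
      else (if (κ r).succ ∉ D then q else 0))
    (hp0 : 0 ≤ p) (hp1 : p ≤ 1) (hq0 : 0 ≤ q) (hq1 : q ≤ 1) (r : Fin m) (D : Finset (Fin (K + 1))) :
    0 ≤ gbar r D ∧ gbar r D ≤ 1 := by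
  rw [hg]; split_ifs <;> constructor <;> linarith

/-- **INTEGRATING OUT `D'`:** `Σ_{D'} Q(D,D')·Φ(D') = Σ_r (t/m)·(γ̄_r(D)·Φ(σ_r D) + (1−γ̄_r(D))·Φ(B_r D))
+ (1−t)·(w₀·Φ(D ∖ {0}) + (1−w₀)·Φ(D))`. [ours] -/
theorem regen_step_potential_eq
    {gbar : Fin m → Finset (Fin (K + 1)) → ℝ} {B : Fin m → Finset (Fin (K + 1)) → Finset (Fin (K + 1))}
    (hQ : ∀ D D', Q D D' = ∑ r : Fin m, t / m *
        (gbar r D * (if D' = D.image (Equiv.swap (0 : Fin (K + 1)) (κ r).succ) then (1 : ℝ) else 0)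
          + (1 - gbar r D) * (if D' = B r D then (1 : ℝ) else 0))
      + (1 - t) * (w₀ * (if D' = D.erase 0 then (1 : ℝ) else 0) + (1 - w₀) * (if D' = D then (1 : ℝ) else 0)))
    (Φ : Finset (Fin (K + 1)) → ℝ) (D : Finset (Fin (K + 1))) :
    ∑ D', Q D D' * Φ D'
      = ∑ r : Fin m, t / m * (gbar r D * Φ (D.image (Equiv.swap (0 : Fin (K + 1)) (κ r).succ))
          + (1 - gbar r D) * Φ (B r D))
        + (1 - t) * (w₀ * Φ (D.erase 0) + (1 - w₀) * Φ D) := by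
  have hδ : ∀ (E : Finset (Fin (K + 1))), ∑ D', (if D' = E then (1 : ℝ) else 0) * Φ D' = Φ E := by
    intro E
    rw [Finset.sum_eq_single E]
    · rw [if_pos rfl, one_mul]
    · intro D' _ h; rw [if_neg h, zero_mul]
    · intro h; exact absurd (mem_univ _) h
  simp_rw [hQ, add_mul, sum_mul, Finset.sum_add_distrib]
  congr 1
  · rw [Finset.sum_comm]
    refine sum_congr rfl fun r _ => ?_
    simp_rw [mul_add, add_mul, Finset.sum_add_distrib, mul_assoc, ← mul_sum, hδ]
  · simp_rw [mul_add, add_mul, Finset.sum_add_distrib, mul_assoc, ← mul_sum, hδ]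

/-- The tag chain `Q` is a transition matrix (`0 ≤ t ≤ 1`, `0 ≤ w₀ ≤ 1`, `0 ≤ p, q ≤ 1`, `m ≥ 1`). [ours] -/
theorem regen_isRowStochastic (hm : 1 ≤ m) (ht0 : 0 ≤ t) (ht1 : t ≤ 1) (hw0 : 0 ≤ w₀) (hw1 : w₀ ≤ 1)
    (hp0 : 0 ≤ p) (hp1 : p ≤ 1) (hq0 : 0 ≤ q) (hq1 : q ≤ 1)
    {gbar : Fin m → Finset (Fin (K + 1)) → ℝ}
    (hg : ∀ r D, gbar r D = if (0 : Fin (K + 1)) ∉ D then (if (κ r).succ ∉ D then (1 : ℝ) else p)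
      else (if (κ r).succ ∉ D then q else 0))
    {B : Fin m → Finset (Fin (K + 1)) → Finset (Fin (K + 1))}
    (hQ : ∀ D D', Q D D' = ∑ r : Fin m, t / m *
        (gbar r D * (if D' = D.image (Equiv.swap (0 : Fin (K + 1)) (κ r).succ) then (1 : ℝ) else 0)
          + (1 - gbar r D) * (if D' = B r D then (1 : ℝ) else 0))
      + (1 - t) * (w₀ * (if D' = D.erase 0 then (1 : ℝ) else 0) + (1 - w₀) * (if D' = D then (1 : ℝ) else 0))) :
    IsRowStochastic Q := by
  have hmpos : (0 : ℝ) < m := Nat.cast_pos.mpr (by omega)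
  refine ⟨fun D D' => ?_, fun D => ?_⟩
  · rw [hQ]
    have hgb := goodWeight_mem κ hg hp0 hp1 hq0 hq1
    refine add_nonneg (sum_nonneg fun r _ => mul_nonneg (by positivity) (add_nonneg ?_ ?_))
      (mul_nonneg (by linarith) (add_nonneg ?_ ?_))
    · exact mul_nonneg (hgb r D).1 (by split_ifs <;> norm_num)
    · exact mul_nonneg (by linarith [(hgb r D).2]) (by split_ifs <;> norm_num)
    · exact mul_nonneg hw0 (by split_ifs <;> norm_num)
    · exact mul_nonneg (by linarith) (by split_ifs <;> norm_num)
  · have h := regen_step_potential_eq κ hQ (fun _ => (1 : ℝ)) D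
    simp only [mul_one] at h
    rw [h]
    have e1 : ∀ r : Fin m, t / m * (gbar r D + (1 - gbar r D)) = t / m := fun r => by ring
    simp_rw [e1]
    rw [sum_const, card_univ, Fintype.card_fin, nsmul_eq_mul]
    field_simp
    ring

/-! ## §2 The drift inequality and the geometric decay of `P(D_n ≠ ∅)` -/

/-- `Φ(D) = b·𝟙{0 ∈ D} + #{k ∈ D : k ≠ 0}`. [ours] -/
theorem tagPotential_eq (b : ℝ) (D : Finset (Fin (K + 1))) :
    ∑ k ∈ D, (if k = (0 : Fin (K + 1)) then b else 1)
      = (if (0 : Fin (K + 1)) ∈ D then b else 0) + ((D.filter (fun k => k ≠ 0)).card : ℝ) := by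
  rw [← Finset.sum_filter_add_sum_filter_not D (fun k => k = (0 : Fin (K + 1)))]
  congr 1
  · rw [Finset.sum_congr rfl (fun k hk => if_pos (Finset.mem_filter.mp hk).2)]
    by_cases h0 : (0 : Fin (K + 1)) ∈ D
    · rw [if_pos h0, Finset.filter_eq' D (0 : Fin (K + 1)), if_pos h0, sum_singleton]
    · rw [if_neg h0, Finset.filter_eq' D (0 : Fin (K + 1)), if_neg h0, sum_empty]
  · rw [Finset.sum_congr rfl (fun k hk => if_neg (Finset.mem_filter.mp hk).2), sum_const, nsmul_eq_mul, mul_one]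

/-- **Every stale cold level is listed at least `c` times:** `c·#{k ∈ D : k ≠ 0} ≤ #{r : l_r ∈ D}`. [ours] -/
theorem hubMult_filter_ge {c : ℕ} (hc : ∀ p' : Fin K, c ≤ (univ.filter (fun r : Fin m => κ r = p')).card)
    (D : Finset (Fin (K + 1))) :
    c * (D.filter (fun k => k ≠ 0)).card ≤ (univ.filter (fun r : Fin m => (κ r).succ ∈ D)).card := by
  rw [Finset.card_eq_sum_card_fiberwise (s := univ.filter (fun r : Fin m => (κ r).succ ∈ D))
    (t := D.filter (fun k => k ≠ 0)) (f := fun r => (κ r).succ)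
    (fun r hr => Finset.mem_filter.mpr ⟨(Finset.mem_filter.mp hr).2, Fin.succ_ne_zero _⟩)]
  rw [Finset.card_eq_sum_ones (D.filter (fun k => k ≠ 0)), Finset.mul_sum]
  refine Finset.sum_le_sum fun k hk => ?_
  obtain ⟨p', rfl⟩ := Fin.exists_succ_eq.mpr (Finset.mem_filter.mp hk).2
  rw [mul_one]
  refine (hc p').trans (Finset.card_le_card fun r hr => ?_)
  rw [Finset.mem_filter] at hr ⊢
  refine ⟨Finset.mem_filter.mpr ⟨mem_univ _, ?_⟩, by rw [hr.2]⟩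
  rw [hr.2]; exact (Finset.mem_filter.mp hk).1

/-- `#{r : l_r ∈ D} + #{r : l_r ∉ D} = m`. [ours] -/
theorem hubMult_filter_add (D : Finset (Fin (K + 1))) :
    ((univ.filter (fun r : Fin m => (κ r).succ ∈ D)).card : ℝ)
      + ((univ.filter (fun r : Fin m => (κ r).succ ∉ D)).card : ℝ) = m := by
  have h := Finset.card_filter_add_card_filter_not (s := (univ : Finset (Fin m))) (fun r : Fin m => (κ r).succ ∈ D)
  rw [card_univ, Fintype.card_fin] at h
  exact_mod_cast h

/-- **THE DRIFT INEQUALITY `QΦ ≤ (1−ρ)Φ`** for `Φ(D) = Σ_{k∈D} φ_k`, `φ_0 = b`, `φ_l = 1`, under: `0 < b ≤ p`,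
`q·b ≤ 1`, `ρ ≤ t·c·(p−b)/m`, `ρ·b ≤ (1−t)w₀·b − t(1−qb)`, `ρ ≤ t(1−qb)c/m` (`c ≤ c_{p'}` the hub multiplicities,
`0 ≤ t`, `m ≥ 1`). [ours] -/
theorem regen_step_potential_le (hm : 1 ≤ m) (ht0 : 0 ≤ t)
    {gbar : Fin m → Finset (Fin (K + 1)) → ℝ}
    (hg : ∀ r D, gbar r D = if (0 : Fin (K + 1)) ∉ D then (if (κ r).succ ∉ D then (1 : ℝ) else p)
      else (if (κ r).succ ∉ D then q else 0))
    {B : Fin m → Finset (Fin (K + 1)) → Finset (Fin (K + 1))}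
    (hB : ∀ r D, B r D = if (0 : Fin (K + 1)) ∉ D ∧ (κ r).succ ∉ D then D
      else insert (0 : Fin (K + 1)) (insert (κ r).succ D))
    (hQ : ∀ D D', Q D D' = ∑ r : Fin m, t / m *
        (gbar r D * (if D' = D.image (Equiv.swap (0 : Fin (K + 1)) (κ r).succ) then (1 : ℝ) else 0)
          + (1 - gbar r D) * (if D' = B r D then (1 : ℝ) else 0))
      + (1 - t) * (w₀ * (if D' = D.erase 0 then (1 : ℝ) else 0) + (1 - w₀) * (if D' = D then (1 : ℝ) else 0)))
    {c : ℕ} (hc : ∀ p' : Fin K, c ≤ (univ.filter (fun r : Fin m => κ r = p')).card)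
    {b ρ : ℝ} (hbp : b ≤ p) (hqb : q * b ≤ 1) (h1 : ρ ≤ t * c * (p - b) / m)
    (h2 : ρ * b ≤ (1 - t) * w₀ * b - t * (1 - q * b)) (h3 : ρ ≤ t * (1 - q * b) * c / m)
    (D : Finset (Fin (K + 1))) :
    ∑ D', Q D D' * ∑ k ∈ D', (if k = (0 : Fin (K + 1)) then b else 1)
      ≤ (1 - ρ) * ∑ k ∈ D, (if k = (0 : Fin (K + 1)) then b else 1) := by
  have hmpos : (0 : ℝ) < m := Nat.cast_pos.mpr (by omega)
  rw [regen_step_potential_eq κ hQ (fun E => ∑ k ∈ E, (if k = (0 : Fin (K + 1)) then b else 1)) D]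
  simp_rw [hB, tagPotential_swapImage κ, tagPotential_badTag κ, hg]
  set Φ := ∑ k ∈ D, (if k = (0 : Fin (K + 1)) then b else 1) with hΦ_def
  set N : ℝ := ((D.filter (fun k => k ≠ 0)).card : ℝ) with hN
  set ND : ℝ := ((univ.filter (fun r : Fin m => (κ r).succ ∈ D)).card : ℝ) with hND
  have hNDc : (c : ℝ) * N ≤ ND := by rw [hN, hND]; exact_mod_cast hubMult_filter_ge κ hc D
  have hN0 : 0 ≤ N := by positivity
  have hsumIn : ∑ r : Fin m, (if (κ r).succ ∈ D then (1 : ℝ) else 0) = ND := by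
    rw [hND, Finset.sum_boole]
  have hsumOut : ∑ r : Fin m, (if (κ r).succ ∈ D then (0 : ℝ) else 1) = m - ND := by
    have : ∑ r : Fin m, (if (κ r).succ ∈ D then (0 : ℝ) else 1) = ∑ r : Fin m, (if (κ r).succ ∉ D then (1 : ℝ) else 0) :=
      sum_congr rfl fun r _ => by by_cases h : (κ r).succ ∈ D <;> simp [h]
    rw [this, Finset.sum_boole]
    have h := hubMult_filter_add κ D
    rw [← hND] at h
    have : (((univ.filter (fun r : Fin m => (κ r).succ ∉ D)).card : ℕ) : ℝ) = m - ND := by linarith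
    exact this
  by_cases h0 : (0 : Fin (K + 1)) ∈ D
  · -- hub stale: `Φ = b + N`; every entry onto a fresh cold level dirties it (gains `1 − qb` in mean)
    have hΦ : Φ = b + N := by rw [hΦ_def, tagPotential_eq, if_pos h0]
    simp only [h0, not_true_eq_false, if_false, if_true]
    have hterm : ∀ r : Fin m, t / m * ((if (κ r).succ ∉ D then q else 0) * (Φ + (if (κ r).succ ∈ D then 0 else 1 - b))
        + (1 - (if (κ r).succ ∉ D then q else 0)) * (Φ + (if (κ r).succ ∈ D then 0 else 1)))
        = t / m * Φ + t / m * (1 - q * b) * (if (κ r).succ ∈ D then (0 : ℝ) else 1) := by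
      intro r
      by_cases hl : (κ r).succ ∈ D
      · simp only [hl, not_true_eq_false, if_false, if_true]; ring
      · simp only [hl, not_false_eq_true, if_true, if_false]; ring
    have hsum1 : ∑ r : Fin m, t / m * ((if (κ r).succ ∉ D then q else 0) * (Φ + (if (κ r).succ ∈ D then 0 else 1 - b))
        + (1 - (if (κ r).succ ∉ D then q else 0)) * (Φ + (if (κ r).succ ∈ D then 0 else 1)))
        = t * Φ + (t * (1 - q * b) - t / m * (1 - q * b) * ND) := by
      rw [sum_congr rfl (fun r _ => hterm r), sum_add_distrib, sum_const, card_univ, Fintype.card_fin, nsmul_eq_mul,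
        ← mul_sum, hsumOut]
      field_simp
    have hErase : ∑ k ∈ D.erase 0, (if k = (0 : Fin (K + 1)) then b else (1 : ℝ)) = Φ - b := by
      have := Finset.sum_erase_add D (fun k => if k = (0 : Fin (K + 1)) then b else (1 : ℝ)) h0
      rw [if_pos rfl] at this
      linarith
    rw [hsum1, hErase, hΦ]
    have hqb0 : 0 ≤ 1 - q * b := by linarith
    have hcold : ρ * N ≤ t / m * (1 - q * b) * ND := by
      calc ρ * N ≤ t * (1 - q * b) * c / m * N := mul_le_mul_of_nonneg_right h3 hN0
        _ = t / m * (1 - q * b) * (c * N) := by ring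
        _ ≤ t / m * (1 - q * b) * ND := mul_le_mul_of_nonneg_left hNDc (by positivity)
    nlinarith [hcold, h2]
  · -- hub fresh: `Φ = N`; every entry onto a stale cold level regenerates it with probability `p`
    have hΦ : Φ = N := by rw [hΦ_def, tagPotential_eq, if_neg h0, zero_add]
    simp only [h0, not_false_eq_true, if_true, if_false]
    have hterm : ∀ r : Fin m, t / m * ((if (κ r).succ ∉ D then (1 : ℝ) else p) * (Φ + (if (κ r).succ ∈ D then b - 1 else 0))
        + (1 - (if (κ r).succ ∉ D then (1 : ℝ) else p)) * (Φ + (if (κ r).succ ∈ D then b else 0)))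
        = t / m * Φ + t / m * (b - p) * (if (κ r).succ ∈ D then (1 : ℝ) else 0) := by
      intro r
      by_cases hl : (κ r).succ ∈ D
      · simp only [hl, not_true_eq_false, if_false, if_true]; ring
      · simp only [hl, not_false_eq_true, if_true, if_false]; ring
    have hsum1 : ∑ r : Fin m, t / m * ((if (κ r).succ ∉ D then (1 : ℝ) else p)
        * (Φ + (if (κ r).succ ∈ D then b - 1 else 0))
        + (1 - (if (κ r).succ ∉ D then (1 : ℝ) else p)) * (Φ + (if (κ r).succ ∈ D then b else 0)))
        = t * Φ + t / m * (b - p) * ND := by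
      rw [sum_congr rfl (fun r _ => hterm r), sum_add_distrib, sum_const, card_univ, Fintype.card_fin, nsmul_eq_mul,
        ← mul_sum, hsumIn]
      field_simp
    rw [hsum1, Finset.erase_eq_of_notMem h0, ← hΦ_def, hΦ]
    have hhub : ρ * N ≤ t / m * (p - b) * ND := by
      calc ρ * N ≤ t * c * (p - b) / m * N := mul_le_mul_of_nonneg_right h1 hN0
        _ = t / m * (p - b) * (c * N) := by ring
        _ ≤ t / m * (p - b) * ND := mul_le_mul_of_nonneg_left hNDc (by
            exact mul_nonneg (div_nonneg ht0 hmpos.le) (by linarith))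
    nlinarith [hhub]

/-- **`P(D_n ≠ ∅) ≤ (1−ρ)ⁿ·(K + b)/b`:** under the drift conditions (and `0 < b ≤ p ≤ 1`, `0 ≤ ρ ≤ 1`, the chain
started from everything stale, `D_0 = univ`). [ours] -/
theorem regen_nonempty_le (hm : 1 ≤ m) (ht0 : 0 ≤ t) (ht1 : t ≤ 1) (hw0 : 0 ≤ w₀) (hw1 : w₀ ≤ 1)
    (hp1 : p ≤ 1) (hq0 : 0 ≤ q) (hq1 : q ≤ 1)
    {gbar : Fin m → Finset (Fin (K + 1)) → ℝ}
    (hg : ∀ r D, gbar r D = if (0 : Fin (K + 1)) ∉ D then (if (κ r).succ ∉ D then (1 : ℝ) else p)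
      else (if (κ r).succ ∉ D then q else 0))
    {B : Fin m → Finset (Fin (K + 1)) → Finset (Fin (K + 1))}
    (hB : ∀ r D, B r D = if (0 : Fin (K + 1)) ∉ D ∧ (κ r).succ ∉ D then D
      else insert (0 : Fin (K + 1)) (insert (κ r).succ D))
    (hQ : ∀ D D', Q D D' = ∑ r : Fin m, t / m *
        (gbar r D * (if D' = D.image (Equiv.swap (0 : Fin (K + 1)) (κ r).succ) then (1 : ℝ) else 0)
          + (1 - gbar r D) * (if D' = B r D then (1 : ℝ) else 0))
      + (1 - t) * (w₀ * (if D' = D.erase 0 then (1 : ℝ) else 0) + (1 - w₀) * (if D' = D then (1 : ℝ) else 0)))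
    {c : ℕ} (hc : ∀ p' : Fin K, c ≤ (univ.filter (fun r : Fin m => κ r = p')).card)
    {b ρ : ℝ} (hb0 : 0 < b) (hbp : b ≤ p) (hρ1 : ρ ≤ 1) (h1 : ρ ≤ t * c * (p - b) / m)
    (h2 : ρ * b ≤ (1 - t) * w₀ * b - t * (1 - q * b)) (h3 : ρ ≤ t * (1 - q * b) * c / m) (n : ℕ) :
    ∑ D ∈ univ.filter (fun D : Finset (Fin (K + 1)) => D ≠ ∅), lawAt Q (Pi.single (univ : Finset (Fin (K + 1))) 1) n D
      ≤ (1 - ρ) ^ n * ((K : ℝ) + b) / b := by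
  have hp0 : 0 ≤ p := hb0.le.trans hbp
  have hb1 : b ≤ 1 := hbp.trans hp1
  have hqb : q * b ≤ 1 := by nlinarith
  set ρ' := lawAt Q (Pi.single (univ : Finset (Fin (K + 1))) 1) n with hρ'
  have hQst := regen_isRowStochastic κ hm ht0 ht1 hw0 hw1 hp0 hp1 hq0 hq1 hg hQ
  have hρ'0 : ∀ D, 0 ≤ ρ' D := fun D => lawAt_nonneg hQst (fun U => by
    by_cases h : U = univ
    · subst h; rw [Pi.single_eq_same]; norm_num
    · rw [Pi.single_eq_of_ne h]) n D
  -- `b·𝟙{D ≠ ∅} ≤ Φ(D)`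
  have hΦge : ∀ D : Finset (Fin (K + 1)), b * (if D ≠ ∅ then (1 : ℝ) else 0)
      ≤ ∑ k ∈ D, (if k = (0 : Fin (K + 1)) then b else 1) := by
    intro D
    split_ifs with hD
    · obtain ⟨k, hk⟩ := Finset.nonempty_iff_ne_empty.mpr hD
      rw [mul_one]
      refine le_trans ?_ (Finset.single_le_sum (f := fun k => if k = (0 : Fin (K + 1)) then b else (1 : ℝ))
        (fun j _ => by split_ifs <;> linarith) hk)
      split_ifs <;> linarith
    · rw [mul_zero]; exact sum_nonneg fun j _ => by split_ifs <;> linarith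
  -- the mean potential decays
  have hdecay := lawMean_lawAt_le_of_step_le hQst (by linarith : (0 : ℝ) ≤ 1 - ρ)
    (regen_step_potential_le κ hm ht0 hg hB hQ hc hbp hqb h1 h2 h3)
    (μ := Pi.single (univ : Finset (Fin (K + 1))) 1) (fun U => by
      by_cases h : U = univ
      · subst h; rw [Pi.single_eq_same]; norm_num
      · rw [Pi.single_eq_of_ne h]) n
  rw [lawMean_single] at hdecay
  have hΦuniv : ∑ k ∈ (univ : Finset (Fin (K + 1))), (if k = (0 : Fin (K + 1)) then b else (1 : ℝ)) = K + b := by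
    rw [Fin.sum_univ_succ, if_pos rfl]
    simp_rw [if_neg (Fin.succ_ne_zero _), sum_const, card_univ, Fintype.card_fin, nsmul_eq_mul, mul_one]
    ring
  rw [hΦuniv] at hdecay
  have hmass : b * ∑ D ∈ univ.filter (fun D : Finset (Fin (K + 1)) => D ≠ ∅), ρ' D ≤ lawMean ρ'
      (fun D => ∑ k ∈ D, (if k = (0 : Fin (K + 1)) then b else 1)) := by
    unfold lawMean
    rw [Finset.sum_filter, mul_sum]
    refine sum_le_sum fun D _ => ?_
    have := mul_le_mul_of_nonneg_left (hΦge D) (hρ'0 D)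
    calc b * (if D ≠ ∅ then ρ' D else 0) = ρ' D * (b * if D ≠ ∅ then (1 : ℝ) else 0) := by split_ifs <;> ring
      _ ≤ ρ' D * ∑ k ∈ D, (if k = (0 : Fin (K + 1)) then b else 1) := this
  rw [le_div_iff₀ hb0]
  linarith

end Regen

end Summit.Ventures.LatticeQCDFlow.Scaling

end
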